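import Summits.AtomisticToContinuum.BoseEinsteinCondensation.Theorems.BECThomsonPrinciplePeriodicToDirichletResidual

/-!
# Line `reward-pays-the-wall` for crux `PeriodicToDirichlet` (stmt-AtomisticToContinuum-9483) — SKELETON
# (lead gen 2, 2026-08-16: fourth reshape = the honest registry over the tree — ONE open stub)

Route `BECThomsonPrinciple`; crux `PeriodicToDirichlet := PeriodicBEC → _root_.BoseEinsteinCondensation`.

Everything this line extracts from the hypothesis `A = PeriodicBEC` is LANDED (`--supports stmt-AtomisticToContinuum-9483`):
gen 0 — `Theorems/BECThomsonPrinciplePeriodicToDirichlet{Defs,CutoffOccupation,MergeOccupation,PaddedCutoffState,RewardedUpperBound,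
RewardSandwich,Anchors}.lean` (p74246 p75283 p75829 p75196 p74991 p74880 p76612); gen 1 — `…Residual.lean` (p85115:
`stub_transfer : TorusBECAt v ρ c → RewardedUpperBound v ρ (min c 1)`, `RewardedUpperBound ⟺ Cond` below the density cap,
`periodicToDirichlet_of_condensedToBEC`). Gen 1 registered `{stub_transfer (proved), stub_condensedToBEC (open)}`; since
`stub_transfer` is a theorem of the imported module, this reshape registers only what is actually open. Over the tree the crux is
implied by the single statement `CondensedToBEC` below ("condensed competitors suffice": in the Dirichlet cubes `Λ_{L_N(ρ)}`,
flat-condensed `N`-body trial states within `o(N)` of `E₀^D` ⟹ `HasGroundStateBEC v ρ`), spelled in Literature-only vocabulary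
(`TrialState`, `energy`, `groundStateEnergy`, `occupation`, `boxConstantMode`, `sideLength`, `HasGroundStateBEC`).

Status of the open stub (lead gen 2 census, NOTES.md / `Lines/reward_pays_the_wall.dead.md`): for `v ≠ 0` it is ground-state BEC of
the dilute gas in one Dirichlet cube given condensed competitors at the right energy density — the open converse of LSSY App. D (D.17);
no soft proof exists (`Theorems/PeriodicToDirichlet/Negative/SoftUnrewardingSchema.not_softUnrewarding_twoState`); convexity links the
reward side (`f′(0⁺) ≤ -c`, which `A` gives) to the penalty side (`f_N′(0⁻) ≤ -c′` eventually, which IS flat-mode BEC) only through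
`f′(0⁻) ≥ f′(0⁺)` — the wrong direction; the `∀ v′` freedom of `A` gives nothing across potentials (admissible interactions are functions
of `|xᵢ - xⱼ|`, translation-invariant, so every instance of `A` is a statement about translation-invariant `γ`'s and cannot see a wall;
scaling covariance maps b.c. to themselves); positivity / heat-kernel domination `k^D ≤ k^per` bound Dirichlet objects from ABOVE only;
rigid translation averaging of `Ψ_D` removes one particle's worth of kinetic energy out of the `O(N^{1/3})`–`O(N^{2/3})` wall. The `v = 0`
instance holds (`condensedToBEC_at_zero`, from `hasGroundStateBEC_zero` p70676).
-/

noncomputable section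

open MeasureTheory Filter
open scoped ENNReal NNReal Topology

namespace Summit.AtomisticToContinuum.BoseEinsteinCondensation.RewardPaysTheWall

open Literature.MathematicalPhysics.QuantumManyBody.BoseGas

/-- **Residual statement** (workfile-local name; its body is verbatim the hypothesis of the landed
`periodicToDirichlet_of_condensedToBEC`, `Theorems/BECThomsonPrinciplePeriodicToDirichletResidual.lean` p85115):
for every repulsive finite-range `v` there is `ρ₄ > 0` such that for `0 < ρ < ρ₄` and `0 < c ≤ 1`: if for
every `θ > 0`, eventually in `N`, some Dirichlet trial state in the box of side `L_N(ρ)` lies within `θN` of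
`E₀^D(N, L_N(ρ))` and has flat-mode occupation `≥ (c - θ)N`, then `HasGroundStateBEC v ρ` (`λ_max(γ)` of the
`δ`-near-minimisers `≥ c'N`, `δ` after `N`). -/
def CondensedToBEC : Prop :=
  ∀ v : ℝ → ℝ≥0∞, IsRepulsiveFiniteRange v → ∃ ρ₄ : ℝ, 0 < ρ₄ ∧ ∀ ρ : ℝ, 0 < ρ → ρ < ρ₄ →
    ∀ c : ℝ, 0 < c → c ≤ 1 →
      (∀ θ : ℝ, 0 < θ → ∀ᶠ N : ℕ in atTop, ∃ Ψ : TrialState N (sideLength ρ N),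
        energy v Ψ ≤ groundStateEnergy v N (sideLength ρ N) + ENNReal.ofReal (θ * N) ∧
          ENNReal.ofReal ((c - θ) * N) ≤ occupation N (boxConstantMode (sideLength ρ N)) Ψ.ψ) →
      HasGroundStateBEC v ρ

/-- **Stub R** (open-problem, HARDEST, held by the lead): condensed near-ground states ⟹ BEC. -/
theorem stub_condensedToBEC : CondensedToBEC := by
  sorry

/-- **The crux from the registered stub (by name)**: `periodicToDirichlet_of_condensedToBEC` (landed, p85115)
applied to `stub_condensedToBEC`. [folklore] -/
theorem periodicToDirichlet_of_registered_stubs :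
    Summit.AtomisticToContinuum.BoseEinsteinCondensation.Theses.BECThomsonPrinciple.PeriodicToDirichlet :=
  periodicToDirichlet_of_condensedToBEC stub_condensedToBEC

/-- The planner's original residual still closes the line: `Unrewarding → CondensedToBEC` (landed glue). [folklore] -/
theorem condensedToBEC_of_unrewarding' (h : Unrewarding) : CondensedToBEC :=
  condensedToBEC_of_unrewarding h

/-- The `v = 0` instance of the registered stub holds outright (landed `condensedToBEC_at_zero`). [folklore] -/
example :
    ∃ ρ₄ : ℝ, 0 < ρ₄ ∧ ∀ ρ : ℝ, 0 < ρ → ρ < ρ₄ → ∀ c : ℝ, 0 < c → c ≤ 1 →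
      (∀ θ : ℝ, 0 < θ → ∀ᶠ N : ℕ in atTop, ∃ Ψ : TrialState N (sideLength ρ N),
        energy 0 Ψ ≤ groundStateEnergy 0 N (sideLength ρ N) + ENNReal.ofReal (θ * N) ∧
          ENNReal.ofReal ((c - θ) * N) ≤ occupation N (boxConstantMode (sideLength ρ N)) Ψ.ψ) →
      HasGroundStateBEC 0 ρ :=
  condensedToBEC_at_zero

end Summit.AtomisticToContinuum.BoseEinsteinCondensation.RewardPaysTheWall

end
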